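import Summits.RiemannHypothesis.RiemannHypothesis.Theses.WeilPos
import Literature.NumberTheory.LFunctions.WeilFirstPrimePositivityC
import HarnessLib

/-!
# Route WeilPos, crux #2 `WeilposRungPrime2`: first-prime Weil positivity — PROVED

`Summit.RiemannHypothesis.RiemannHypothesis.Theses.WeilPos.WeilposRungPrime2`
(`= WeilPositivityOn ((log 3)/2)`) by the kernel-checked Stage-C first-prime certificate
(`Literature.NumberTheory.LFunctions.weilPositivityOn_log_three_half`).
-/

noncomputable section

namespace Summit.RiemannHypothesis.RiemannHypothesis.Theorems

/-- **First-prime Weil positivity** (route WeilPos crux #2): `Re W(g ⋆ g̃) ≥ 0` for Weil test functions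
supported in `[−(log 3)/2, (log 3)/2]`. [cite: Yoshida1992, Thm 1 (p. 310), §6 (method); certificate new] -/
theorem WeilposRungPrime2_proof : Summit.RiemannHypothesis.RiemannHypothesis.Theses.WeilPos.WeilposRungPrime2 := by
  unfold Summit.RiemannHypothesis.RiemannHypothesis.Theses.WeilPos.WeilposRungPrime2
  exact Literature.NumberTheory.LFunctions.weilPositivityOn_log_three_half

end Summit.RiemannHypothesis.RiemannHypothesis.Theorems
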